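import Summits.AtomisticToContinuum.FouriersLaw.Theorems.PhononMeanFreePathIncoherentChannelTimeResolvedBudget
import Summits.AtomisticToContinuum.FouriersLaw.Theorems.PhononMeanFreePathIncoherentChannelTimeReversal

/-!
# `IncoherentChannel`, line `two-horizons-forecast-loss` — the dissipation inequality on a SHIFTED window

Helper file for crux `PhononMeanFreePath.IncoherentChannel` (item stmt-AtomisticToContinuum-11811, route
`PhononMeanFreePath`, sub-problem `FouriersLaw`), registered stub `dissipation_lintegral_le_shifted`. For the
pinned anharmonic chain `P = pinnedChain ω₂ lam β γ` on `N ≥ 1` sites with both Langevin baths at `T > 0` write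
`μ_T = P.gibbsMeasure N T` (invariant probability), `K_s = P.transitionKernel N T T s⁺` (Markov kernels) and
`u_s = K_s F` for the forecasts of a continuous compactly supported observable `F`. The tree has the time-resolved
dissipation (energy) inequality on the window `(0, t]`
(`dissipation_lintegral_le_timeResolved_of_smooth`, file `…TimeResolvedBudgetHelper1`):

  `‖u_t‖²_{L²(μ_T)} + ∫_{0<s≤t} ∫ 2Γ(u_s) dμ_T ds ≤ ∫ F² dμ_T`,  `2Γ(f) = 2γ ∑_i w_i (∂_{p_i} f)²`,
  `w_i = [i=0]T + [i=N-1]T`.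

This file proves the same inequality on the SHIFTED window `(t₁, t₁ + t]` (`t₁ ≥ 0`, `t > 0`):

  `‖u_{t₁+t}‖²_{L²(μ_T)} + ∫_{0<s≤t} ∫ 2Γ(u_{t₁+s}) dμ_T ds ≤ ‖u_{t₁}‖²_{L²(μ_T)}`

(`dissipation_lintegral_le_shifted`, registered signature). Route: the proof of the unshifted inequality uses the
compact support of `F` ONLY to bound `F`; `dissipation_lintegral_le_timeResolved_of_bounded_smooth` is that proof
for a BOUNDED continuous `F` (smooth forecasts assumed). It is then applied to the shifted observable
`F' = u_{t₁} = K_{t₁} F`, which is bounded by `sup |F|`, continuous (Feller property,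
`pinnedChain_continuous_integral_transitionKernel`), and whose forecasts are `K_s F' = u_{t₁+s}` by
Chapman–Kolmogorov (`forecast_add`), hence `C²` for `s > 0` (`contDiff_forecast`, hypoellipticity).
No definitions; nothing here closes an item.
-/

noncomputable section

namespace Summit.AtomisticToContinuum.FouriersLaw.Theorems.PhononMeanFreePath

open MeasureTheory ProbabilityTheory Set Filter Topology
open scoped NNReal ENNReal ContDiff
open Literature.MathematicalPhysics.KineticTheory.HeatConduction
open Literature.MathematicalPhysics.KineticTheory Literature.Probability.Process OscillatorChain
open Summit.AtomisticToContinuum.FouriersLaw.Theorems.IncoherentBounded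
open Summit.AtomisticToContinuum.FouriersLaw.Theorems.SubdiffusiveBondHeat

section Dissipation

variable {N : ℕ} {ω₂ lam β γ : ℝ} (hω : 0 < ω₂) (hl : 0 ≤ lam) (hβ : 0 < β) (hγ : 0 < γ)
  (hN : 0 < N) {T : ℝ} (hT : 0 < T)
include hω hl hβ hγ hN hT

/-- **The time-resolved dissipation inequality of the equilibrium semigroup for a BOUNDED continuous observable**
(smooth forecasts assumed). Let `T_L = T_R = T > 0`, `μ_T` the Gibbs measure, `F` continuous with `‖F‖ ≤ M`, and
assume the forecasts `u_s = K_s F` are `C²` in the starting point for `s > 0`. Then for every `t > 0`, with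
`2Γ(f) = 2γ ∑_i w_i (∂_{p_i} f)²`,

  `‖u_t‖²_{L²(μ_T)} + ∫_{0<s≤t} ∫ 2Γ(u_s) dμ_T ds ≤ ∫ F² dμ_T`

(lower Lebesgue integral in `s`). Proof: `g(s) = ‖u_s‖²` is bounded by `‖F‖²` and NON-INCREASING
(`g(s) - g(s+h) = ∫ Var_{K_h(x,·)}(u_s) dμ_T(x) ≥ 0`, Chapman–Kolmogorov + invariance); Fatou in `x` on the one-step
variance expansion gives `∫ 2Γ(u_s) dμ_T ≤ liminf_h (g(s) - g(s+h))/h`; for `S + h ≤ t`,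
`∫_0^S (g(s) - g(s+h)) ds = ∫_0^h g - ∫_S^{S+h} g ≤ h‖F‖² - h g(t)`; Fatou in `s` on `(0, S]` and `S ↑ t`.
(adapted from `dissipation_lintegral_le_timeResolved_of_smooth`, file `…TimeResolvedBudgetHelper1`, whose proof
uses the compact support of `F` only to bound `F`) [folklore] -/
theorem dissipation_lintegral_le_timeResolved_of_bounded_smooth {F : PhaseSpace N → ℝ} (hFc : Continuous F)
    {M : ℝ} (hM : ∀ x, ‖F x‖ ≤ M)
    (hsmooth : ∀ s : ℝ, 0 < s → ContDiff ℝ 2 fun x : PhaseSpace N =>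
      ∫ y, F y ∂((pinnedChain ω₂ lam β γ).transitionKernel N T T s.toNNReal x)) {t : ℝ} (ht : 0 < t) :
    ENNReal.ofReal (∫ x, (∫ y, F y ∂((pinnedChain ω₂ lam β γ).transitionKernel N T T t.toNNReal x)) ^ 2
        ∂((pinnedChain ω₂ lam β γ).gibbsMeasure N T)) +
      ∫⁻ s in Ioc (0 : ℝ) t, ∫⁻ x, ENNReal.ofReal (2 * (γ * ∑ i : Fin N,
        ((if i.val = 0 then T else 0) + (if i.val = N - 1 then T else 0)) *
          partialP i (fun z => ∫ y, F y ∂((pinnedChain ω₂ lam β γ).transitionKernel N T T s.toNNReal z)) x ^ 2))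
        ∂((pinnedChain ω₂ lam β γ).gibbsMeasure N T) ≤
      ENNReal.ofReal (∫ x, F x ^ 2 ∂((pinnedChain ω₂ lam β γ).gibbsMeasure N T)) := by
  -- adapted from `dissipation_lintegral_le_timeResolved_of_smooth` (file `…TimeResolvedBudgetHelper1`)
  set P := pinnedChain ω₂ lam β γ with hP
  set μ := P.gibbsMeasure N T with hμ
  haveI : IsProbabilityMeasure μ := pinnedChain_isProbabilityMeasure_gibbsMeasure hω hl hβ.le γ N hT
  haveI hMK : ∀ t, IsMarkovKernel (P.transitionKernel N T T t) := fun t =>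
    pinnedChain_isMarkovKernel_transitionKernel hω hl hβ.le hγ.le N T T t
  -- the forecast `U s x = K_{s⁺} F (x)` and its bound
  set U : ℝ → PhaseSpace N → ℝ := fun s x => ∫ y, F y ∂(P.transitionKernel N T T s.toNNReal x) with hU
  have hM' : ∀ z, |F z| ≤ M := fun z => by rw [← Real.norm_eq_abs]; exact hM z
  have hM0 : 0 ≤ M := (norm_nonneg _).trans (hM 0)
  have hUb : ∀ s x, |U s x| ≤ M := fun s x =>
    (integrable_and_abs_integral_le (ν := P.transitionKernel N T T s.toNNReal x) hFc.measurable hM').2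
  have hUsm : StronglyMeasurable (Function.uncurry U) :=
    stronglyMeasurable_forecast hω hl hβ.le hγ.le T T hFc
  have hUm : ∀ s, Measurable (U s) := fun s => (hUsm.comp_measurable measurable_prodMk_left).measurable
  have hU2b : ∀ s z, |U s z ^ 2| ≤ M ^ 2 := fun s z => by
    rw [abs_pow]; exact pow_le_pow_left₀ (abs_nonneg _) (hUb s z) 2
  -- the carré du champ density along the forecast
  set Γ2 : ℝ → PhaseSpace N → ℝ := fun s x => 2 * (γ * ∑ i : Fin N,
      ((if i.val = 0 then T else 0) + (if i.val = N - 1 then T else 0)) * partialP i (U s) x ^ 2) with hΓ2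
  -- `g(s) = ‖u_s‖²` and its bound (Jensen + invariance: `pinnedChain_integral_sq_act_le`)
  set g : ℝ → ℝ := fun s => ∫ x, U s x ^ 2 ∂μ with hg
  set Cg : ℝ := ∫ x, F x ^ 2 ∂μ with hCg
  show ENNReal.ofReal (g t) + ∫⁻ s in Ioc (0 : ℝ) t, ∫⁻ x, ENNReal.ofReal (Γ2 s x) ∂μ ≤ ENNReal.ofReal Cg
  have hϑ0 : (0 : ℝ) < 1 / (4 * T) := by positivity
  have h2ϑ : 2 * (1 / (4 * T)) < 1 / T := by
    rw [show 2 * (1 / (4 * T)) = 1 / (2 * T) by field_simp; ring, div_lt_div_iff₀ (by positivity) hT]; nlinarith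
  have hFexp : ∀ y, |F y| ≤ M * Real.exp (1 / (4 * T) * P.hamiltonian N y) := fun y =>
    (hM' y).trans (le_mul_of_one_le_right hM0 (Real.one_le_exp (mul_nonneg hϑ0.le
      (pinnedChain_hamiltonian_nonneg hω.le hl hβ.le γ N y))))
  have hgle : ∀ s, g s ≤ Cg := fun s =>
    (pinnedChain_integral_sq_act_le hω hl hβ hγ hN hT hϑ0 h2ϑ hFc hFexp s.toNNReal).2.2
  have hg0 : ∀ s, 0 ≤ g s := fun s => integral_nonneg fun x => sq_nonneg _
  have hgm : Measurable g := by
    have h1 : StronglyMeasurable fun q : ℝ × PhaseSpace N => Function.uncurry U q ^ 2 :=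
      (hUsm.measurable.pow_const 2).stronglyMeasurable
    exact (h1.integral_prod_right' (ν := μ)).measurable
  -- the conditional variance `V h s x = ∫ u_s² dK_h(x,·) - (∫ u_s dK_h(x,·))²`
  set V : ℝ≥0 → ℝ → PhaseSpace N → ℝ := fun h s x =>
    (∫ z, U s z ^ 2 ∂(P.transitionKernel N T T h x)) - (∫ z, U s z ∂(P.transitionKernel N T T h x)) ^ 2 with hV
  have hA : ∀ (h : ℝ≥0) s, Measurable (fun x => ∫ z, U s z ^ 2 ∂(P.transitionKernel N T T h x)) ∧
      ∀ x, |∫ z, U s z ^ 2 ∂(P.transitionKernel N T T h x)| ≤ M ^ 2 := fun h s =>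
    ⟨(((hUm s).pow_const 2).stronglyMeasurable.integral_kernel (κ := P.transitionKernel N T T h)).measurable,
      fun x => (integrable_and_abs_integral_le ((hUm s).pow_const 2) (hU2b s)).2⟩
  have hB : ∀ (h : ℝ≥0) s, Measurable (fun x => ∫ z, U s z ∂(P.transitionKernel N T T h x)) ∧
      ∀ x, |∫ z, U s z ∂(P.transitionKernel N T T h x)| ≤ M := fun h s =>
    ⟨((hUm s).stronglyMeasurable.integral_kernel (κ := P.transitionKernel N T T h)).measurable,
      fun x => (integrable_and_abs_integral_le (hUm s) (hUb s)).2⟩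
  have hV0 : ∀ h s x, 0 ≤ V h s x := fun h s x =>
    sub_nonneg.2 (sq_integral_le_integral_sq (integrable_and_abs_integral_le (hUm s) (hUb s)).1
      (integrable_and_abs_integral_le ((hUm s).pow_const 2) (hU2b s)).1)
  have hVm : ∀ h s, Measurable (V h s) := fun h s => (hA h s).1.sub ((hB h s).1.pow_const 2)
  have hVb : ∀ h s x, |V h s x| ≤ M ^ 2 := fun h s x => by
    rw [abs_of_nonneg (hV0 h s x)]
    have h1 := (le_abs_self _).trans ((hA h s).2 x)
    have h2 := sq_nonneg (∫ z, U s z ∂(P.transitionKernel N T T h x))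
    show (∫ z, U s z ^ 2 ∂(P.transitionKernel N T T h x)) - (∫ z, U s z ∂(P.transitionKernel N T T h x)) ^ 2 ≤ M ^ 2
    linarith
  -- `g s - g (s+h) = ∫ V h s dμ` (Chapman–Kolmogorov + invariance of μ)
  have hgV : ∀ (h : ℝ≥0) (s : ℝ), 0 ≤ s → g s - g (s + h) = ∫ x, V h s x ∂μ := by
    intro h s hs
    have hcomp : ∀ x, U (s + h) x = ∫ z, U s z ∂(P.transitionKernel N T T h x) := fun x => by
      have e := forecast_add hω hl hβ.le hγ.le T T hFc hM' hs (NNReal.coe_nonneg h) x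
      rw [Real.toNNReal_coe] at e
      exact e
    have hinv : ∫ x, (∫ z, U s z ^ 2 ∂(P.transitionKernel N T T h x)) ∂μ = ∫ x, U s x ^ 2 ∂μ :=
      pinnedChain_integral_transitionKernel_gibbsMeasure hω hl hβ.le hγ.le hN hT h
        (integrable_and_abs_integral_le (ν := μ) ((hUm s).pow_const 2) (hU2b s)).1
    have hAi : Integrable (fun x => ∫ z, U s z ^ 2 ∂(P.transitionKernel N T T h x)) μ :=
      (integrable_and_abs_integral_le (hA h s).1 (hA h s).2).1
    have hBi : Integrable (fun x => (∫ z, U s z ∂(P.transitionKernel N T T h x)) ^ 2) μ :=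
      (integrable_and_abs_integral_le ((hB h s).1.pow_const 2) (C := M ^ 2) fun x => by
        rw [abs_pow]; exact pow_le_pow_left₀ (abs_nonneg _) ((hB h s).2 x) 2).1
    calc g s - g (s + h) = (∫ x, U s x ^ 2 ∂μ) - ∫ x, U (s + h) x ^ 2 ∂μ := rfl
      _ = (∫ x, (∫ z, U s z ^ 2 ∂(P.transitionKernel N T T h x)) ∂μ) -
            ∫ x, (∫ z, U s z ∂(P.transitionKernel N T T h x)) ^ 2 ∂μ := by
          rw [hinv]; simp only [hcomp]
      _ = ∫ x, V h s x ∂μ := by rw [← integral_sub hAi hBi]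
  -- `g` is non-increasing on `[0, ∞)`
  have hganti : ∀ {s u : ℝ}, 0 ≤ s → s ≤ u → g u ≤ g s := by
    intro s u hs hsu
    have e := hgV (u - s).toNNReal s hs
    rw [Real.coe_toNNReal _ (sub_nonneg.2 hsu), add_sub_cancel] at e
    have h0 : 0 ≤ g s - g u := by rw [e]; exact integral_nonneg fun x => hV0 _ _ _
    linarith
  -- the sequence of steps `h_k = 1/(k+1)`
  set hk : ℕ → ℝ≥0 := fun k => ((k : ℝ≥0) + 1)⁻¹ with hhk
  have hk_pos : ∀ k, 0 < (hk k : ℝ) := fun k => by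
    rw [hhk]; dsimp only; rw [NNReal.coe_inv]; positivity
  have hk_tend : Tendsto (fun k => (hk k : ℝ)) atTop (𝓝 0) := by
    have : (fun k : ℕ => (hk k : ℝ)) = fun k : ℕ => 1 / ((k : ℝ) + 1) := by
      funext k; rw [hhk]; dsimp only; rw [NNReal.coe_inv]; push_cast; ring
    rw [this]; exact tendsto_one_div_add_atTop_nhds_zero_nat
  -- pointwise limit of `V/h` (the one-step variance expansion at a point)
  have hlim : ∀ s, 0 < s → ∀ x, Tendsto (fun k => V (hk k) s x / (hk k : ℝ)) atTop (𝓝 (Γ2 s x)) := by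
    intro s hs x
    rw [Metric.tendsto_atTop]
    intro ε hε
    obtain ⟨h₀, hh₀, H⟩ := kernel_variance_step_of_bounded hω hl hβ.le hγ.le hN hT.le hT.le (hsmooth s hs)
      (hUb s) x (half_pos hε)
    obtain ⟨K, hK⟩ := eventually_atTop.1 (hk_tend.eventually (Iic_mem_nhds hh₀))
    refine ⟨K, fun k hkK => ?_⟩
    have e : |V (hk k) s x - (hk k : ℝ) * Γ2 s x| ≤ ε / 2 * (hk k : ℝ) :=
      H (hk k) (hk_pos k) (mem_Iic.1 (hK k hkK))
    rw [Real.dist_eq]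
    have hne : (hk k : ℝ) ≠ 0 := (hk_pos k).ne'
    have : V (hk k) s x / (hk k : ℝ) - Γ2 s x = (V (hk k) s x - (hk k : ℝ) * Γ2 s x) / (hk k : ℝ) := by
      rw [eq_div_iff hne, sub_mul, div_mul_cancel₀ _ hne, mul_comm (hk k : ℝ) (Γ2 s x)]
    rw [this, abs_div, abs_of_pos (hk_pos k), div_lt_iff₀ (hk_pos k)]
    calc |V (hk k) s x - (hk k : ℝ) * Γ2 s x| ≤ ε / 2 * (hk k : ℝ) := e
      _ < ε * (hk k : ℝ) := by nlinarith [hk_pos k]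
  -- Fatou in `x`
  have hFx : ∀ s, 0 < s →
      ∫⁻ x, ENNReal.ofReal (Γ2 s x) ∂μ ≤ liminf (fun k => ENNReal.ofReal ((g s - g (s + hk k)) / hk k)) atTop := by
    intro s hs
    have h1 : ∀ x, liminf (fun k => ENNReal.ofReal (V (hk k) s x / hk k)) atTop = ENNReal.ofReal (Γ2 s x) :=
      fun x => (ENNReal.tendsto_ofReal (hlim s hs x)).liminf_eq
    have hVint : ∀ k, Integrable (fun x => V (hk k) s x / hk k) μ := fun k =>
      ((integrable_and_abs_integral_le (hVm _ s) (hVb _ s)).1).div_const _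
    calc ∫⁻ x, ENNReal.ofReal (Γ2 s x) ∂μ
        = ∫⁻ x, liminf (fun k => ENNReal.ofReal (V (hk k) s x / hk k)) atTop ∂μ :=
          lintegral_congr fun x => (h1 x).symm
      _ ≤ liminf (fun k => ∫⁻ x, ENNReal.ofReal (V (hk k) s x / hk k) ∂μ) atTop :=
          lintegral_liminf_le fun k => ((hVm _ s).div_const _).ennreal_ofReal
      _ = liminf (fun k => ENNReal.ofReal ((g s - g (s + hk k)) / hk k)) atTop := by
          refine Filter.liminf_congr (Eventually.of_forall fun k => ?_)
          rw [← ofReal_integral_eq_lintegral_ofReal (hVint k)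
            (Eventually.of_forall fun x => div_nonneg (hV0 _ _ _) (hk_pos k).le), integral_div, hgV (hk k) s hs.le]
  -- the WINDOWED telescoping bound `∫_{0<s≤S} (g s - g (s+h))/h ds ≤ Cg - g t` for `S + h ≤ t`
  have hgii : ∀ a b : ℝ, IntervalIntegrable g volume a b := fun a b =>
    (intervalIntegrable_const (c := Cg)).mono_fun' hgm.aestronglyMeasurable
      (Eventually.of_forall fun s => by
        show ‖g s‖ ≤ Cg
        rw [Real.norm_eq_abs, abs_of_nonneg (hg0 s)]; exact hgle s)
  have htel : ∀ {h : ℝ}, 0 < h → ∀ {S : ℝ}, 0 ≤ S →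
      ∫ s in (0 : ℝ)..S, (g s - g (s + h)) = (∫ s in (0 : ℝ)..h, g s) - ∫ s in S..(S + h), g s := by
    intro h hh S hS
    rw [intervalIntegral.integral_sub (hgii 0 S) ((IntervalIntegrable.comp_add_right_iff (f := g) (a := 0)
      (b := S)).mpr (hgii (0 + h) (S + h))), intervalIntegral.integral_comp_add_right g h, zero_add]
    have e1 := intervalIntegral.integral_add_adjacent_intervals (hgii 0 h) (hgii h (S + h))
    have e2 := intervalIntegral.integral_add_adjacent_intervals (hgii 0 S) (hgii S (S + h))
    linarith
  have hwin : ∀ {h : ℝ}, 0 < h → ∀ {S : ℝ}, 0 ≤ S → S + h ≤ t →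
      ∫⁻ s in Ioc (0 : ℝ) S, ENNReal.ofReal ((g s - g (s + h)) / h) ≤ ENNReal.ofReal (Cg - g t) := by
    intro h hh S hS hSt
    have hdm : Measurable fun s => (g s - g (s + h)) / h :=
      (hgm.sub (hgm.comp (measurable_id.add_const h))).div_const h
    have hdi : IntegrableOn (fun s => (g s - g (s + h)) / h) (Ioc (0 : ℝ) S) := by
      refine (integrableOn_const (C := (2 * Cg) / h) (hs := measure_Ioc_lt_top.ne)).mono' hdm.aestronglyMeasurable
        (Eventually.of_forall fun s => ?_)
      show ‖(g s - g (s + h)) / h‖ ≤ 2 * Cg / h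
      rw [Real.norm_eq_abs, abs_div, abs_of_pos hh]
      gcongr
      have := hgle s; have := hg0 s; have := hgle (s + h); have := hg0 (s + h)
      rw [abs_le]; constructor <;> linarith
    have hnn : 0 ≤ᵐ[volume.restrict (Ioc (0 : ℝ) S)] fun s => (g s - g (s + h)) / h := by
      rw [EventuallyLE, ae_restrict_iff' measurableSet_Ioc]
      refine Eventually.of_forall fun s hs => div_nonneg ?_ hh.le
      show 0 ≤ g s - g (s + h)
      exact sub_nonneg.2 (hganti hs.1.le (by linarith))
    rw [← ofReal_integral_eq_lintegral_ofReal hdi hnn]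
    refine ENNReal.ofReal_le_ofReal ?_
    rw [← intervalIntegral.integral_of_le hS, intervalIntegral.integral_div, htel hh hS]
    have h1 : ∫ s in (0 : ℝ)..h, g s ≤ h * Cg := by
      have := intervalIntegral.integral_mono_on hh.le (hgii 0 h) intervalIntegrable_const fun s _ => hgle s
      simpa using this
    have h2 : h * g t ≤ ∫ s in S..(S + h), g s := by
      have := intervalIntegral.integral_mono_on (by linarith : S ≤ S + h) intervalIntegrable_const (hgii S (S + h))
        fun s hs => (hganti (hS.trans hs.1) (hs.2.trans hSt) : g t ≤ g s)
      simpa using this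
    rw [div_le_iff₀ hh]
    linarith
  -- Fatou in `s` on the windows `(0, S]`, `S < t`
  set G : ℕ → ℝ → ℝ≥0∞ := fun k s => ENNReal.ofReal ((g s - g (s + hk k)) / hk k) with hG
  have hGm : ∀ k, Measurable (G k) := fun k =>
    ((hgm.sub (hgm.comp (measurable_id.add_const _))).div_const _).ennreal_ofReal
  have hSbound : ∀ S : ℝ, 0 ≤ S → S < t →
      ∫⁻ s in Ioc (0 : ℝ) S, ∫⁻ x, ENNReal.ofReal (Γ2 s x) ∂μ ≤ ENNReal.ofReal (Cg - g t) := by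
    intro S hS0 hSt
    have hev : ∀ᶠ k in atTop, ∫⁻ s in Ioc (0 : ℝ) S, G k s ≤ ENNReal.ofReal (Cg - g t) := by
      filter_upwards [hk_tend.eventually (Iic_mem_nhds (sub_pos.2 hSt))] with k hk'
      have hk'' : (hk k : ℝ) ≤ t - S := hk'
      exact hwin (hk_pos k) hS0 (by linarith)
    calc ∫⁻ s in Ioc (0 : ℝ) S, ∫⁻ x, ENNReal.ofReal (Γ2 s x) ∂μ
        ≤ ∫⁻ s in Ioc (0 : ℝ) S, liminf (fun k => G k s) atTop :=
          setLIntegral_mono' measurableSet_Ioc fun s hs => hFx s hs.1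
      _ ≤ liminf (fun k => ∫⁻ s in Ioc (0 : ℝ) S, G k s) atTop := lintegral_liminf_le hGm
      _ ≤ ENNReal.ofReal (Cg - g t) := liminf_le_of_frequently_le' hev.frequently
  -- exhaustion `(0, t) = ⋃_n (0, t - t/(n+2)]` and `(0, t) = (0, t]` a.e.
  set Sn : ℕ → ℝ := fun n => t - t / ((n : ℝ) + 2) with hSn
  have hSn0 : ∀ n, 0 ≤ Sn n := fun n => by
    rw [hSn]; dsimp only
    rw [sub_nonneg, div_le_iff₀ (by positivity)]
    nlinarith [ht, (n.cast_nonneg : (0 : ℝ) ≤ n)]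
  have hSnt : ∀ n, Sn n < t := fun n => by
    rw [hSn]; dsimp only
    have : 0 < t / ((n : ℝ) + 2) := by positivity
    linarith
  have hSnmono : Monotone Sn := fun a b hab => by
    have hab' : (a : ℝ) ≤ b := by exact_mod_cast hab
    rw [hSn]; dsimp only
    gcongr
  have hUnion : Ioo (0 : ℝ) t = ⋃ n : ℕ, Ioc (0 : ℝ) (Sn n) := by
    ext s
    simp only [mem_Ioo, mem_iUnion, mem_Ioc]
    constructor
    · rintro ⟨hs0, hst⟩
      have hts : 0 < t - s := sub_pos.2 hst
      obtain ⟨n, hn⟩ := exists_nat_ge (t / (t - s))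
      have h1 : t ≤ n * (t - s) := (div_le_iff₀ hts).1 hn
      refine ⟨n, hs0, ?_⟩
      show s ≤ t - t / ((n : ℝ) + 2)
      rw [le_sub_comm, div_le_iff₀ (by positivity)]
      nlinarith
    · rintro ⟨n, hs0, hsn⟩
      exact ⟨hs0, lt_of_le_of_lt hsn (hSnt n)⟩
  have hdir : Directed (· ⊆ ·) fun n : ℕ => Ioc (0 : ℝ) (Sn n) :=
    Monotone.directed_le fun a b hab => Ioc_subset_Ioc_right (hSnmono hab)
  have hIoo : ∫⁻ s in Ioo (0 : ℝ) t, ∫⁻ x, ENNReal.ofReal (Γ2 s x) ∂μ ≤ ENNReal.ofReal (Cg - g t) := by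
    rw [hUnion, setLIntegral_iUnion_of_directed _ hdir]
    exact iSup_le fun n => hSbound (Sn n) (hSn0 n) (hSnt n)
  have hIoc : ∫⁻ s in Ioc (0 : ℝ) t, ∫⁻ x, ENNReal.ofReal (Γ2 s x) ∂μ =
      ∫⁻ s in Ioo (0 : ℝ) t, ∫⁻ x, ENNReal.ofReal (Γ2 s x) ∂μ :=
    setLIntegral_congr Ioo_ae_eq_Ioc.symm
  -- conclusion: `g t + (Cg - g t) = Cg`
  calc ENNReal.ofReal (g t) + ∫⁻ s in Ioc (0 : ℝ) t, ∫⁻ x, ENNReal.ofReal (Γ2 s x) ∂μ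
      ≤ ENNReal.ofReal (g t) + ENNReal.ofReal (Cg - g t) := by rw [hIoc]; exact add_le_add le_rfl hIoo
    _ = ENNReal.ofReal Cg := by
        rw [← ENNReal.ofReal_add (hg0 t) (sub_nonneg.2 (hgle t)), add_sub_cancel]

end Dissipation

/-- **THE DISSIPATION INEQUALITY ON A SHIFTED TIME WINDOW** (registered stub `dissipation_lintegral_le_shifted` of
line `two-horizons-forecast-loss`): for the pinned anharmonic chain on `N ≥ 1` sites (`ω₂, β, γ > 0`, `lam ≥ 0`)
with both baths at `T > 0`, every `F ∈ C_c(Ω)`, every `t₁ ≥ 0` and every horizon `t > 0`, the forecasts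
`u_s = K_s F` satisfy

  `‖u_{t₁+t}‖²_{L²(μ_T)} + ∫_{0<s≤t} ∫ 2γ ∑_i ([i=0]T + [i=N-1]T) (∂_{p_i} u_{t₁+s})² dμ_T ds ≤ ‖u_{t₁}‖²_{L²(μ_T)}`

— the integrated Bakry–Émery identity `d/ds ‖u_s‖² = -2∫Γ(u_s) dμ_T` on the window `(t₁, t₁ + t]`, as an
inequality of lower Lebesgue integrals. Proof: `dissipation_lintegral_le_timeResolved_of_bounded_smooth` for the
bounded continuous observable `F' = u_{t₁}` (Feller property), whose forecasts are `K_s F' = u_{t₁+s}`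
(Chapman–Kolmogorov, `forecast_add`), `C²` for `s > 0` (`contDiff_forecast`). [folklore] -/
theorem dissipation_lintegral_le_shifted : ∀ ω₂ lam β γ : ℝ, 0 < ω₂ → 0 ≤ lam → 0 < β → 0 < γ → ∀ N : ℕ, 0 < N → ∀ T : ℝ, 0 < T → ∀ F : PhaseSpace N → ℝ, Continuous F → HasCompactSupport F → ∀ t₁ t : ℝ, 0 ≤ t₁ → 0 < t → ENNReal.ofReal (∫ x, (∫ y, F y ∂((pinnedChain ω₂ lam β γ).transitionKernel N T T (t₁ + t).toNNReal x)) ^ 2 ∂((pinnedChain ω₂ lam β γ).gibbsMeasure N T)) + ∫⁻ s in Ioc (0 : ℝ) t, ∫⁻ x, ENNReal.ofReal (2 * (γ * ∑ i : Fin N, ((if i.val = 0 then T else 0) + (if i.val = N - 1 then T else 0)) * partialP i (fun z => ∫ y, F y ∂((pinnedChain ω₂ lam β γ).transitionKernel N T T (t₁ + s).toNNReal z)) x ^ 2)) ∂((pinnedChain ω₂ lam β γ).gibbsMeasure N T) ≤ ENNReal.ofReal (∫ x, (∫ y, F y ∂((pinnedChain ω₂ lam β γ).transitionKernel N T T t₁.toNNReal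 x)) ^ 2 ∂((pinnedChain ω₂ lam β γ).gibbsMeasure N T)) := by
  intro ω₂ lam β γ hω hl hβ hγ N hN T hT F hFc hFs t₁ t ht₁ ht
  obtain ⟨M, hM⟩ : ∃ M, ∀ x, ‖F x‖ ≤ M := hFc.bounded_above_of_compact_support hFs
  have hM' : ∀ z, |F z| ≤ M := fun z => by rw [← Real.norm_eq_abs]; exact hM z
  haveI hMK : ∀ s, IsMarkovKernel ((pinnedChain ω₂ lam β γ).transitionKernel N T T s) := fun s =>
    pinnedChain_isMarkovKernel_transitionKernel hω hl hβ.le hγ.le N T T s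
  -- the shifted observable `F' = u_{t₁} = K_{t₁} F`: continuous (Feller) and bounded by `M`
  set F' : PhaseSpace N → ℝ := fun x =>
    ∫ y, F y ∂((pinnedChain ω₂ lam β γ).transitionKernel N T T t₁.toNNReal x) with hF'
  have hF'c : Continuous F' :=
    pinnedChain_continuous_integral_transitionKernel hω hl hβ.le hγ.le N T T t₁.toNNReal hFc hM
  have hF'b : ∀ x, ‖F' x‖ ≤ M := fun x => by
    rw [Real.norm_eq_abs]
    exact (integrable_and_abs_integral_le
      (ν := (pinnedChain ω₂ lam β γ).transitionKernel N T T t₁.toNNReal x) hFc.measurable hM').2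
  -- Chapman–Kolmogorov: `K_s F' = u_{t₁+s}` for `s ≥ 0`, pointwise and as functions
  have hpt : ∀ s : ℝ, 0 ≤ s → ∀ x : PhaseSpace N,
      ∫ y, F' y ∂((pinnedChain ω₂ lam β γ).transitionKernel N T T s.toNNReal x) =
        ∫ y, F y ∂((pinnedChain ω₂ lam β γ).transitionKernel N T T (t₁ + s).toNNReal x) :=
    fun s hs x => (forecast_add hω hl hβ.le hγ.le T T hFc hM' ht₁ hs x).symm
  have hCK : ∀ s : ℝ, 0 ≤ s →
      (fun z => ∫ y, F' y ∂((pinnedChain ω₂ lam β γ).transitionKernel N T T s.toNNReal z)) =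
        fun z => ∫ y, F y ∂((pinnedChain ω₂ lam β γ).transitionKernel N T T (t₁ + s).toNNReal z) :=
    fun s hs => funext fun z => hpt s hs z
  -- smoothness of the forecasts of `F'` (hypoellipticity at time `t₁ + s > 0`)
  have hsmooth : ∀ s : ℝ, 0 < s → ContDiff ℝ 2 fun x : PhaseSpace N =>
      ∫ y, F' y ∂((pinnedChain ω₂ lam β γ).transitionKernel N T T s.toNNReal x) := fun s hs => by
    rw [hCK s hs.le]
    exact contDiff_forecast hω hl hγ hN hβ.le hT hT.le hFc hFs (by linarith : 0 < t₁ + s)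
  have key := dissipation_lintegral_le_timeResolved_of_bounded_smooth hω hl hβ hγ hN hT hF'c hF'b hsmooth ht
  have hA : (∫ x, (∫ y, F' y ∂((pinnedChain ω₂ lam β γ).transitionKernel N T T t.toNNReal x)) ^ 2
      ∂((pinnedChain ω₂ lam β γ).gibbsMeasure N T)) =
      ∫ x, (∫ y, F y ∂((pinnedChain ω₂ lam β γ).transitionKernel N T T (t₁ + t).toNNReal x)) ^ 2
        ∂((pinnedChain ω₂ lam β γ).gibbsMeasure N T) := by
    simp_rw [hpt t ht.le]
  have hB : (∫⁻ s in Ioc (0 : ℝ) t, ∫⁻ x, ENNReal.ofReal (2 * (γ * ∑ i : Fin N,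
        ((if i.val = 0 then T else 0) + (if i.val = N - 1 then T else 0)) *
          partialP i (fun z => ∫ y, F' y ∂((pinnedChain ω₂ lam β γ).transitionKernel N T T s.toNNReal z)) x ^ 2))
        ∂((pinnedChain ω₂ lam β γ).gibbsMeasure N T)) =
      ∫⁻ s in Ioc (0 : ℝ) t, ∫⁻ x, ENNReal.ofReal (2 * (γ * ∑ i : Fin N,
        ((if i.val = 0 then T else 0) + (if i.val = N - 1 then T else 0)) *
          partialP i (fun z => ∫ y, F y ∂((pinnedChain ω₂ lam β γ).transitionKernel N T T (t₁ + s).toNNReal z))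
            x ^ 2)) ∂((pinnedChain ω₂ lam β γ).gibbsMeasure N T) :=
    setLIntegral_congr_fun measurableSet_Ioc fun s hs => by rw [hCK s hs.1.le]
  rw [hA, hB] at key
  exact key

end Summit.AtomisticToContinuum.FouriersLaw.Theorems.PhononMeanFreePath

end
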